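/-
Copyright: the b2b-balaban T⁴-continuum CRUX team, row NE7b leaf lineage `t4-ne7b-formalise-leaf-06` (gen 153). Project licence.
-/
import Mathlib.Analysis.Calculus.SmoothSeries
import Mathlib.Analysis.Calculus.IteratedDeriv.Lemmas
import Mathlib.Analysis.SpecialFunctions.Trigonometric.Deriv

/-!
# THE LATTICE SYMBOL IN SEVERAL VARIABLES SUPPLIES IHPC §4's FOUR LETTERS: for `Φ(q) = Σ'_i k i·cos(L_i q)` on ANY real normed space
# `E` with continuous linear frequencies `L_i : E →L ℝ` and summable moments `Σ' |k i|·‖L_i‖ⁿ` (`n ≤ N`): `Φ ∈ Cᴺ(E)`, EVEN, `Φ(0) = Σ' k i`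
# ((W) = «annihilates constants»), the OPERATOR-NORM letter `‖DⁿΦ(q)‖ ≤ Σ' |k i|·‖L_i‖ⁿ` at every `q` (IHPC's own (D) currency), and the
# Hessian `D²Φ(0)[u,v] = −Σ' k i·(L_i u)(L_i v)` (row NE7b, node U5c; the several-variables companion of `…LatticeKernelMoments{,Summable}`;
# [folklore] dominated differentiation of series)

Cell `pub-balaban`, sub-cell `t4`, spine estimate NE7b (`T4WeightBudget.RelWeightBound`; the cell's OWN estimate — NOT PRINTED in
[Bałaban 1983–89], NOT PROVED).  Crux-route work under `Spine/NE7b/` by a row leaf on the convexity road under FREEZE (0)'s crux-prover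
clause; NOTHING of Bałaban's is named or asserted; no `T4Continuum/Support` leaf typed; no `def`; zero `sorry`.  Imports: Mathlib only
(IHPC ∕ IHPCL ∕ LKM ∕ LKMS ∕ CSKM have no hub olean at the time of writing — nothing of theirs imported or restated; the junction with
IHPC §4 ∕ IHPCL §6 is one `exact` per letter once their oleans exist, certificate by source concat until then).

WHY.  IHPC (leaf-01) bounds the inherited Hessian letters UNIFORMLY in `k` from four displayed letters per kernel `Φ : E → ℝ` read as a
function of MOMENTUM: (W) `Φ 0 = 0`, (R) `Φ` even, (S) the quadratic part split, (D) `‖D⁴Φ q‖ ≤ K₄` on the ball (its §4 asks GLOBAL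
`Φ ∈ C⁴(E)`; this lineage's IHPCL the local∕diagonal∕Lagrange variants).  LKM (finite support, one variable along rays) and this lineage's
LKMS (summable moments, one variable) say WHERE the letters come from for a lattice kernel; CSKM supplies (S) from cubic symmetry.  What no
file states yet is the `E`-LEVEL object IHPC actually consumes: the symbol as a function on the momentum SPACE, `Φ(q) = Σ'_i k i·cos(L_i q)`,
with its regularity, evenness, value at `0`, operator-norm derivative letters and Hessian — THIS FILE.  Every `DⁿΦ(q)` is the series of
`k i·cos⁽ⁿ⁾(L_i q)·(L_i ⊗ … ⊗ L_i)`, whose operator norm is `≤ |k i|·‖L_i‖ⁿ`; Mathlib's `contDiff_tsum` ∕ `iteratedFDeriv_tsum_apply` do the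
rest.  For the lattice `ℤ^ι` with `E = ι → ℝ` (sup norm) and `L_x = Σ_j x_j·proj_j`, `‖L_x‖ ≤ Σ_j |x_j|` (§4), so the moments are
`Σ' |k x|·‖x‖₁ⁿ` — finite under print's tree decay (LKMS §4's shape).

WHAT IS PROVED ([folklore]; Mathlib's `ContinuousLinearMap.iteratedFDeriv_comp_right`, `ContinuousMultilinearMap.norm_compContinuousLinearMap_le`,
`norm_iteratedFDeriv_eq_norm_iteratedDeriv`, `abs_iteratedDeriv_cos_le_one`, `iteratedFDeriv_apply_eq_iteratedDeriv_mul_prod`, `contDiff_tsum`,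
`iteratedFDeriv_tsum_apply`, `ContinuousLinearMap.map_tsum` BY NAME; `E` a real normed space, `k : ι → ℝ`, `L : ι → (E →L[ℝ] ℝ)`):
* §1 ONE TERM `q ↦ k·cos(L q)`: `iteratedFDeriv_cosTerm` (`Dⁿ(k·cos ∘ L)(q) = (Dⁿ(k·cos))(L q) ∘ (L, …, L)`), `contDiff_cosTerm`,
  **`norm_iteratedFDeriv_cosTerm_le`** (`‖Dⁿ(k·cos ∘ L)(q)‖ ≤ |k|·‖L‖ⁿ`), `iteratedFDeriv_two_cosTerm_zero` (`D²(k·cos ∘ L)(0)[u,v] = −k·(L u)(L v)`).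
* §2 THE SYMBOL (`hmom : ∀ n ≤ N, Summable (|k ·|·‖L ·‖ⁿ)`): **`contDiff_latticeSymbol`** (`Φ ∈ Cᴺ(E)`), **`norm_iteratedFDeriv_latticeSymbol_le`**
  (`‖DⁿΦ(q)‖ ≤ Σ' |k i|·‖L_i‖ⁿ` for `n ≤ N`, EVERY `q` — IHPC §4's (D) letter with `K₄ = Σ' |k i|·‖L_i‖⁴`, and IHPCL §6's `_of_opNorm` door),
  `latticeSymbol_neg` ((R)), `latticeSymbol_zero` (`Φ 0 = Σ' k i`; (W) ⟺ `Σ' k i = 0`), **`iteratedFDeriv_two_latticeSymbol_zero`**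
  (`D²Φ(0)[u,v] = −Σ' k i·(L_i u)(L_i v)`, `2 ≤ N` — the marginal part IS minus the second-moment form).
* §3 THE PACKAGE `latticeSymbol_letters` (`N = 4`, Ward `Σ' k i = 0`): `ContDiff ℝ 4 Φ ∧ (∀ q, Φ (−q) = Φ q) ∧ Φ 0 = 0 ∧ ∀ q, ‖D⁴Φ q‖ ≤ Σ' |k i|·‖L_i‖⁴`
  — IHPC §4 `norm_sub_half_hessian_le_of_iteratedFDeriv_four_le`'s hypotheses VERBATIM in shape (global `C⁴`, even, `Φ 0 = 0`, the ball
  letter a fortiori), hence `|Φ q − ½D²Φ(0)[q,q]| ≤ (K₄∕6)‖q‖⁴` there, `(K₄∕24)‖q‖⁴` by IHPCL §6 — one `exact` each (olean-gated; not restated).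
* §4 THE LATTICE FREQUENCIES on `E = ι → ℝ` (`ι` finite, sup norm): `norm_sumProj_le` (`‖Σ_j x_j·proj_j‖ ≤ Σ_j |x_j|`), so the moments of §2 are
  bounded by `Σ' |k x|·(Σ_j |x_j|)ⁿ` (`summable_moment_of_l1_moment`).
* §5 toy (kernel): one term on `E = ℝ`, `L = id`: the §2 letters specialise (`example`).

NOT HERE (honest): the subtracted letter itself (IHPC §4 ∕ IHPCL §6 BY NAME — olean-gated; LKMS §3 has the one-variable ray version with
`1∕24`); (S) (CSKM: cubic symmetry of `(k, L)`); the decay ⟹ moments step on `ℤ^ι` (LKMS §4 on `ℤ`; the `ℤ^ι` version is the product of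
one-dimensional sums — not typed); form-valued kernels; WHICH kernels print's inherited terms have ((A3)∕(A1c), NC-NE7b-α UNRULED); anything of
Bałaban's.  BY-NAME EFFECT ON THE WALL: NONE (a supplier for IHPC's displayed letters).  NE7b NOT PRINTED ∕ NOT PROVED; spine PROVED 0∕9; rung
(B)+1 on a FINITE torus — NOT infinite volume, NOT the mass gap, NOT Clay.  HONEST DEPENDENCY: continuum YM on T⁴ ⇐ BetaPertH ∧ nine spine
estimates (0∕9 proved); BetaPertH ⇐ (D1) ∧ (D4) ∧ CAP+tail; G-an2-4 gates asym, D1 and NE2∕3∕4.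
-/

set_option autoImplicit false

noncomputable section

open Set Filter Topology Real

namespace Summit.QuantumFields.BalabanUV.T4Continuum.NE7b.LatticeSymbolHessianLetters

variable {E : Type*} [NormedAddCommGroup E] [NormedSpace ℝ E] {ι : Type*}

/-! ## §1 One term `q ↦ k·cos(L q)` -/

/-- The scalar profile `t ↦ k·cos t` is smooth. -/
theorem contDiff_kcos (k : ℝ) {n : WithTop ℕ∞} : ContDiff ℝ n fun t : ℝ => k * cos t :=
  contDiff_const.mul contDiff_cos

/-- `‖Dⁿ(k·cos)(t)‖ ≤ |k|` (`|cos⁽ⁿ⁾| ≤ 1`). [folklore] -/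
theorem norm_iteratedFDeriv_kcos_le (k : ℝ) (n : ℕ) (t : ℝ) : ‖iteratedFDeriv ℝ n (fun s : ℝ => k * cos s) t‖ ≤ |k| := by
  rw [norm_iteratedFDeriv_eq_norm_iteratedDeriv, iteratedDeriv_const_mul_field, Real.norm_eq_abs, abs_mul]
  exact mul_le_of_le_one_right (abs_nonneg k) (abs_iteratedDeriv_cos_le_one n t)

/-- **THE CHAIN RULE FOR A LINEAR FREQUENCY, EVERY ORDER**: `Dⁿ(k·cos ∘ L)(q) = (Dⁿ(k·cos))(L q) ∘ (L, …, L)`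
(Mathlib's `ContinuousLinearMap.iteratedFDeriv_comp_right`). [folklore] -/
theorem iteratedFDeriv_cosTerm (k : ℝ) (L : E →L[ℝ] ℝ) (n : ℕ) (q : E) :
    iteratedFDeriv ℝ n (fun q : E => k * cos (L q)) q
      = (iteratedFDeriv ℝ n (fun s : ℝ => k * cos s) (L q)).compContinuousLinearMap fun _ => L := by
  have hfun : (fun q : E => k * cos (L q)) = (fun s : ℝ => k * cos s) ∘ ⇑L := rfl
  rw [hfun, L.iteratedFDeriv_comp_right (contDiff_kcos k) q (i := n) (by exact_mod_cast le_top)]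

/-- Each term is smooth on `E`. -/
theorem contDiff_cosTerm (k : ℝ) (L : E →L[ℝ] ℝ) {n : WithTop ℕ∞} : ContDiff ℝ n fun q : E => k * cos (L q) :=
  (contDiff_kcos k).comp L.contDiff

/-- **THE UNIFORM TERMWISE OPERATOR-NORM BOUND**: `‖Dⁿ(k·cos ∘ L)(q)‖ ≤ |k|·‖L‖ⁿ` at every `q`. [folklore] -/
theorem norm_iteratedFDeriv_cosTerm_le (k : ℝ) (L : E →L[ℝ] ℝ) (n : ℕ) (q : E) :
    ‖iteratedFDeriv ℝ n (fun q : E => k * cos (L q)) q‖ ≤ |k| * ‖L‖ ^ n := by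
  rw [iteratedFDeriv_cosTerm]
  refine (ContinuousMultilinearMap.norm_compContinuousLinearMap_le _ _).trans ?_
  rw [Finset.prod_const, Finset.card_univ, Fintype.card_fin]
  exact mul_le_mul_of_nonneg_right (norm_iteratedFDeriv_kcos_le k n (L q)) (by positivity)

/-- **THE HESSIAN OF ONE TERM AT `0`**: `D²(k·cos ∘ L)(0)[u,v] = −k·(L u)(L v)` (`cos″(0) = −1`). [folklore] -/
theorem iteratedFDeriv_two_cosTerm_zero (k : ℝ) (L : E →L[ℝ] ℝ) (u v : E) :
    iteratedFDeriv ℝ 2 (fun q : E => k * cos (L q)) 0 ![u, v] = -(k * (L u * L v)) := by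
  rw [iteratedFDeriv_cosTerm, ContinuousMultilinearMap.compContinuousLinearMap_apply, map_zero,
    iteratedFDeriv_apply_eq_iteratedDeriv_mul_prod, iteratedDeriv_const_mul_field, iteratedDeriv_even_cos 1]
  simp [Fin.prod_univ_two]
  ring

/-! ## §2 The symbol `Φ(q) = Σ' k i·cos(L_i q)` with summable moments -/

section Symbol

variable {k : ι → ℝ} {L : ι → (E →L[ℝ] ℝ)} {N : ℕ}

/-- The moment hypotheses in the shape `contDiff_tsum` consumes. -/
theorem summable_bound_of_moments (hmom : ∀ n : ℕ, n ≤ N → Summable fun i => |k i| * ‖L i‖ ^ n) :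
    ∀ n : ℕ, (n : ℕ∞) ≤ (N : ℕ∞) → Summable fun i => |k i| * ‖L i‖ ^ n :=
  fun n hn => hmom n (by exact_mod_cast hn)

/-- **THE SYMBOL IS `Cᴺ` ON THE MOMENTUM SPACE** (Mathlib's `contDiff_tsum`). [folklore] -/
theorem contDiff_latticeSymbol (hmom : ∀ n : ℕ, n ≤ N → Summable fun i => |k i| * ‖L i‖ ^ n) :
    ContDiff ℝ N fun q : E => ∑' i, k i * cos (L i q) :=
  contDiff_tsum (N := (N : ℕ∞)) (fun i => contDiff_cosTerm (k i) (L i)) (summable_bound_of_moments hmom)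
    fun n i q _ => norm_iteratedFDeriv_cosTerm_le (k i) (L i) n q

/-- **THE OPERATOR-NORM DERIVATIVE LETTER IS THE MOMENT**: `‖DⁿΦ(q)‖ ≤ Σ' |k i|·‖L_i‖ⁿ` for `n ≤ N`, at EVERY `q` — IHPC §4's (D) currency
with `K₄ = Σ' |k i|·‖L_i‖⁴`. [folklore] -/
theorem norm_iteratedFDeriv_latticeSymbol_le (hmom : ∀ n : ℕ, n ≤ N → Summable fun i => |k i| * ‖L i‖ ^ n) {n : ℕ}
    (hn : n ≤ N) (q : E) : ‖iteratedFDeriv ℝ n (fun q : E => ∑' i, k i * cos (L i q)) q‖ ≤ ∑' i, |k i| * ‖L i‖ ^ n := by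
  rw [iteratedFDeriv_tsum_apply (N := (N : ℕ∞)) (fun i => contDiff_cosTerm (k i) (L i)) (summable_bound_of_moments hmom)
    (fun n i q _ => norm_iteratedFDeriv_cosTerm_le (k i) (L i) n q) (by exact_mod_cast hn) q]
  exact tsum_of_norm_bounded (hmom n hn).hasSum fun i => norm_iteratedFDeriv_cosTerm_le (k i) (L i) n q

/-- **EVEN** (letter (R)): `Φ(−q) = Φ(q)`. [folklore] -/
theorem latticeSymbol_neg (k : ι → ℝ) (L : ι → (E →L[ℝ] ℝ)) (q : E) :
    (∑' i, k i * cos (L i (-q))) = ∑' i, k i * cos (L i q) := by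
  simp [map_neg, cos_neg]

/-- **AT ZERO MOMENTUM THE SYMBOL IS THE TOTAL MASS** ((W) ⟺ `Σ' k i = 0`): `Φ(0) = Σ' k i`. [folklore] -/
theorem latticeSymbol_zero (k : ι → ℝ) (L : ι → (E →L[ℝ] ℝ)) : (∑' i, k i * cos (L i (0 : E))) = ∑' i, k i := by
  simp

/-- **THE HESSIAN AT `0` IS MINUS THE SECOND-MOMENT FORM**: `D²Φ(0)[u,v] = −Σ' k i·(L_i u)(L_i v)` (`2 ≤ N`; evaluation at `(u, v)`
commutes with the CMM-summable series by `ContinuousLinearMap.map_tsum`). [folklore] -/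
theorem iteratedFDeriv_two_latticeSymbol_zero (hmom : ∀ n : ℕ, n ≤ N → Summable fun i => |k i| * ‖L i‖ ^ n) (hN : 2 ≤ N)
    (u v : E) : iteratedFDeriv ℝ 2 (fun q : E => ∑' i, k i * cos (L i q)) 0 ![u, v] = -∑' i, k i * (L i u * L i v) := by
  have hsum : Summable fun i => iteratedFDeriv ℝ 2 (fun q : E => k i * cos (L i q)) 0 :=
    Summable.of_norm_bounded (hmom 2 hN) fun i => norm_iteratedFDeriv_cosTerm_le (k i) (L i) 2 0
  rw [iteratedFDeriv_tsum_apply (N := (N : ℕ∞)) (fun i => contDiff_cosTerm (k i) (L i)) (summable_bound_of_moments hmom)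
    (fun n i q _ => norm_iteratedFDeriv_cosTerm_le (k i) (L i) n q) (by exact_mod_cast hN) 0]
  have h := (ContinuousMultilinearMap.apply ℝ (fun _ : Fin 2 => E) ℝ ![u, v]).map_tsum hsum
  simp only [ContinuousMultilinearMap.apply_apply] at h
  rw [h, ← tsum_neg]
  exact tsum_congr fun i => iteratedFDeriv_two_cosTerm_zero (k i) (L i) u v

end Symbol

/-! ## §3 The package: IHPC §4's hypotheses for the symbol, discharged -/

/-- **IHPC §4's FOUR LETTERS FOR A LATTICE SYMBOL** [folklore]: moments of order `≤ 4` summable and the Ward letter `Σ' k i = 0` ⟹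
`Φ ∈ C⁴(E)`, `Φ` even, `Φ 0 = 0`, and `‖D⁴Φ(q)‖ ≤ K₄ := Σ' |k i|·‖L_i‖⁴` at every `q` — the hypotheses of
`…InheritedHessianPowerCounting.norm_sub_half_hessian_le_of_iteratedFDeriv_four_le` (global `C⁴`, constant `K₄∕6`) and of
`…InheritedHessianPowerCountingLocal.abs_sub_half_hessian_le_on_closedBall_of_opNorm` (`U = univ`, constant `K₄∕24`), verbatim in shape. -/
theorem latticeSymbol_letters {k : ι → ℝ} {L : ι → (E →L[ℝ] ℝ)}
    (hmom : ∀ n : ℕ, n ≤ 4 → Summable fun i => |k i| * ‖L i‖ ^ n) (hW : ∑' i, k i = 0) :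
    ContDiff ℝ 4 (fun q : E => ∑' i, k i * cos (L i q)) ∧ (∀ q : E, (∑' i, k i * cos (L i (-q))) = ∑' i, k i * cos (L i q))
      ∧ (∑' i, k i * cos (L i (0 : E))) = 0 ∧
      ∀ q : E, ‖iteratedFDeriv ℝ 4 (fun q : E => ∑' i, k i * cos (L i q)) q‖ ≤ ∑' i, |k i| * ‖L i‖ ^ 4 :=
  ⟨contDiff_latticeSymbol (N := 4) hmom, latticeSymbol_neg k L, by rw [latticeSymbol_zero]; exact hW,
    fun q => norm_iteratedFDeriv_latticeSymbol_le (N := 4) hmom le_rfl q⟩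

/-! ## §4 The lattice frequencies on `E = ι → ℝ` (sup norm): `‖Σ_j x_j·proj_j‖ ≤ Σ_j |x_j|` -/

section Lattice

variable {κ : Type*} [Fintype κ]

/-- **THE FREQUENCY OF A LATTICE POINT HAS NORM AT MOST ITS `ℓ¹` SIZE**: on `κ → ℝ` with the sup norm,
`‖Σ_j x_j·proj_j‖ ≤ Σ_j |x_j|`. [folklore] -/
theorem norm_sumProj_le (x : κ → ℤ) :
    ‖∑ j, ((x j : ℤ) : ℝ) • (ContinuousLinearMap.proj j : (κ → ℝ) →L[ℝ] ℝ)‖ ≤ ∑ j, |((x j : ℤ) : ℝ)| := by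
  refine (norm_sum_le _ _).trans (Finset.sum_le_sum fun j _ => ?_)
  rw [norm_smul, Real.norm_eq_abs]
  refine mul_le_of_le_one_right (abs_nonneg _) ?_
  exact ContinuousLinearMap.opNorm_le_bound _ zero_le_one fun u => by rw [one_mul]; exact norm_le_pi_norm u j

/-- **MOMENTS FROM `ℓ¹`-MOMENTS**: `Σ' |k x|·(Σ_j |x_j|)ⁿ < ∞` ⟹ `Σ' |k x|·‖L_x‖ⁿ < ∞` for the lattice frequencies `L_x = Σ_j x_j·proj_j`.
[folklore] -/
theorem summable_moment_of_l1_moment {k : (κ → ℤ) → ℝ} {n : ℕ}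
    (h : Summable fun x : κ → ℤ => |k x| * (∑ j, |((x j : ℤ) : ℝ)|) ^ n) :
    Summable fun x : κ → ℤ => |k x| * ‖∑ j, ((x j : ℤ) : ℝ) • (ContinuousLinearMap.proj j : (κ → ℝ) →L[ℝ] ℝ)‖ ^ n :=
  Summable.of_nonneg_of_le (fun x => by positivity)
    (fun x => mul_le_mul_of_nonneg_left (pow_le_pow_left₀ (norm_nonneg _) (norm_sumProj_le x) n) (abs_nonneg _)) h

/-- The lattice frequency evaluates as the pairing: `(Σ_j x_j·proj_j) q = Σ_j x_j·q_j`. [folklore] -/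
theorem sumProj_apply (x : κ → ℤ) (q : κ → ℝ) :
    (∑ j, ((x j : ℤ) : ℝ) • (ContinuousLinearMap.proj j : (κ → ℝ) →L[ℝ] ℝ)) q = ∑ j, ((x j : ℤ) : ℝ) * q j := by
  simp

end Lattice

/-! ## §5 Toy (kernel): one frequency on `E = ℝ` -/

/-- One term (`ι = Unit`, `k = 1`, `L = id` on `ℝ`): the fourth-derivative letter reads `‖D⁴cos(q)‖ ≤ 1·‖id‖⁴`. -/
example (q : ℝ) :
    ‖iteratedFDeriv ℝ 4 (fun q : ℝ => ∑' _ : Unit, (1 : ℝ) * cos ((ContinuousLinearMap.id ℝ ℝ) q)) q‖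
      ≤ ∑' _ : Unit, |(1 : ℝ)| * ‖ContinuousLinearMap.id ℝ ℝ‖ ^ 4 :=
  norm_iteratedFDeriv_latticeSymbol_le (N := 4) (k := fun _ : Unit => (1 : ℝ)) (L := fun _ => ContinuousLinearMap.id ℝ ℝ)
    (fun n _ => by
      haveI : Fintype Unit := inferInstance
      exact (hasSum_fintype _).summable) le_rfl q

end Summit.QuantumFields.BalabanUV.T4Continuum.NE7b.LatticeSymbolHessianLetters

end
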